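import Summits.NavierStokesRegularity.FunctionalMining.StrainMomentHolder
import Summits.NavierStokesRegularity.FunctionalMining.VorticityMomentProduction
import HarnessLib

/-!
# FunctionalMining — the static production bounds for `∫|S|^q` at a real exponent `q > 2` on `T³`

Search for candidate a priori estimates; no regularity claim. Cell `pub-nsfunc`, prove seat
(gen 10). With `φ = |S| = ‖strainFlat v‖`, `F = ∫φ^q = ∫|S|^q`, `Z = ∫φ² = ℰ`,
`I = ∫ φ^{q−2} ∑ₖ∑ᵢⱼ(∂ₖSᵢⱼ)²`, `a = (3q−3)/(5q−6)`, `σ = 2q − 3`: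

* `StrainMoment.exists_top_rpow` — the top Lebesgue node for the strain at a real parameter:
  `∫ φ^{3q} ≤ C_T I³` (codomain-generic `CodomainNP.exists_integral_norm_rpow_top_le_three` at
  `a = (q−2)/2` applied to the flattened strain, `∑ₖ‖∂ₖ strainFlat v‖² = ∑ₖ∑ᵢⱼ(∂ₖSᵢⱼ)²`);
* `StrainMoment.nonlinear_production_rpow_le` — for smooth divergence-free `v`:
  `|∫(|S|²)^{q/2−1}N| ≤ √2 K^{1/q} (C_T I³)^{a/3} (Z F^{1+1/σ})^{1−a}`;
* `StrainMoment.pressure_production_rpow_le` — along a classical solution of unforced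
  Navier–Stokes, at every time of the window:
  `|∫(|S|²)^{q/2−1}∑SᵢⱼHᵢⱼ| ≤ √2 (9^q C_P K)^{1/q} (C_T I³)^{a/3} (Z F^{1+1/σ})^{1−a}`.

The exponent bookkeeping is SIEVELD §3.2's (`VorticityMoment.production_rpow_bookkeeping`, the
vorticity file `VorticityMomentProduction`), fed with the strain inputs of `StrainMomentHolder`.
-/

noncomputable section

open MeasureTheory Finset Set Filter Topology
open scoped InnerProductSpace RealInnerProductSpace ContDiff

namespace Summit.NavierStokesRegularity.FunctionalMining

open Literature.Analysis.FunctionSpaces Literature.Analysis.FunctionSpaces.Torus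
  Literature.Analysis.FluidPDE

namespace StrainMoment

open StrainL4 NonlinearPoincare

/-! ## 1. The top node for the strain at a real parameter -/

/-- **Top node for the strain on `T³`, real `q > 2`:** there is `C ≥ 0` with
`∫ |S|^{3q} ≤ C (∫ |S|^{q−2} ∑ₖ∑ᵢⱼ(∂ₖSᵢⱼ)²)³` for every smooth velocity field
(`CodomainNP.exists_integral_norm_rpow_top_le_three` at `a = (q−2)/2` for `strainFlat v`). [ours] -/
theorem exists_top_rpow {q : ℝ} (hq : 2 < q) :
    ∃ C : ℝ, 0 ≤ C ∧ ∀ v : UnitAddTorus (Fin 3) → EuclideanSpace ℝ (Fin 3), IsSmooth v →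
      ∫ x, ‖strainFlat v x‖ ^ (3 * q) ≤
        C * (∫ x, ‖strainFlat v x‖ ^ (q - 2) * ∑ k, ∑ i, ∑ j,
          ((partialDeriv k (partialDeriv j v) x i +
            partialDeriv k (partialDeriv i v) x j) / 2) ^ 2) ^ 3 := by
  have ha : 0 < (q - 2) / 2 := by linarith
  obtain ⟨C, hC0, hC⟩ := CodomainNP.exists_integral_norm_rpow_top_le_three
    (F := EuclideanSpace ℝ (Fin 3 × Fin 3)) (d := Fin 3) (by simp) ha
  refine ⟨C, hC0, fun v hv => ?_⟩
  have h := hC (strainFlat v) (isSmooth_strainFlat hv) (hasZeroMean_strainFlat hv)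
  rw [show 6 * ((q - 2) / 2) + 6 = 3 * q by ring, show 2 * ((q - 2) / 2) = q - 2 by ring] at h
  simp only [sum_norm_partialDeriv_strainFlat_sq hv] at h
  exact h

/-! ## 2. The nonlinear production -/

/-- **Nonlinear production bound (static, `T³`, real `q > 2`).** With a top-node constant `C_T`
(`∫φ^{3q} ≤ C_T I³`) and a strain Calderón–Zygmund constant `K` at `s = 2q`
(`∫g^q ≤ K∫φ^{2q}`): for every smooth divergence-free `v` on `T³`,
`|∫(|S|²)^{q/2−1}N| ≤ √2 K^{1/q} (C_T I³)^{a/3} (∫φ² · (∫φ^q)^{1+1/(2q−3)})^{1−a}`,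
`a = (3q−3)/(5q−6)`. [ours] -/
theorem nonlinear_production_rpow_le {CT K q : ℝ} (hK0 : 0 ≤ K) (hq : 2 < q)
    (hCT : ∀ w : UnitAddTorus (Fin 3) → EuclideanSpace ℝ (Fin 3), IsSmooth w →
      ∫ x, ‖strainFlat w x‖ ^ (3 * q) ≤
        CT * (∫ x, ‖strainFlat w x‖ ^ (q - 2) * ∑ k, ∑ i, ∑ j,
          ((partialDeriv k (partialDeriv j w) x i +
            partialDeriv k (partialDeriv i w) x j) / 2) ^ 2) ^ 3)
    (hK : ∀ w : UnitAddTorus (Fin 3) → EuclideanSpace ℝ (Fin 3), IsSmooth w → IsDivFree w →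
      ∫ x, (∑ k, ‖partialDeriv k w x‖ ^ 2) ^ q ≤ K * ∫ x, ‖strainFlat w x‖ ^ (2 * q))
    {v : UnitAddTorus (Fin 3) → EuclideanSpace ℝ (Fin 3)} (hv : IsSmooth v) (hdiv : IsDivFree v) :
    |∫ x, torusStrainSqAt v x ^ (q / 2 - 1) * ∑ i, ∑ j,
        (partialDeriv j v x i + partialDeriv i v x j) / 2 *
          ∑ k, partialDeriv i v x k * partialDeriv k v x j| ≤
      Real.sqrt 2 * K ^ (1 / q) *
        (CT * (∫ x, ‖strainFlat v x‖ ^ (q - 2) * ∑ k, ∑ i, ∑ j,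
          ((partialDeriv k (partialDeriv j v) x i +
            partialDeriv k (partialDeriv i v) x j) / 2) ^ 2) ^ 3) ^
          ((3 * q - 3) / (5 * q - 6) / 3) *
        ((∫ x, ‖strainFlat v x‖ ^ (2 : ℝ)) *
          (∫ x, ‖strainFlat v x‖ ^ q) ^ (1 + (2 * q - 3)⁻¹)) ^ (1 - (3 * q - 3) / (5 * q - 6)) := by
  have hφc : Continuous (strainFlat v) := continuous_strainFlat hv
  have hgc := VorticityL4.continuous_gradSq hv
  have hg0 : ∀ x, 0 ≤ ∑ k, ‖partialDeriv k v x‖ ^ 2 := fun x =>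
    Finset.sum_nonneg fun k _ => sq_nonneg _
  -- the quantities
  obtain ⟨F, hF⟩ : ∃ F : ℝ, F = ∫ x, ‖strainFlat v x‖ ^ q := ⟨_, rfl⟩
  obtain ⟨G, hG⟩ : ∃ G : ℝ, G = ∫ x, (∑ k, ‖partialDeriv k v x‖ ^ 2) ^ q := ⟨_, rfl⟩
  obtain ⟨A₂, hA₂⟩ : ∃ A : ℝ, A = ∫ x, ‖strainFlat v x‖ ^ (2 * q) := ⟨_, rfl⟩
  obtain ⟨A, hA⟩ : ∃ A : ℝ, A = ∫ x, ‖strainFlat v x‖ ^ (3 * q) := ⟨_, rfl⟩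
  obtain ⟨Z, hZ⟩ : ∃ Z : ℝ, Z = ∫ x, ‖strainFlat v x‖ ^ (2 : ℝ) := ⟨_, rfl⟩
  obtain ⟨I, hI⟩ : ∃ I : ℝ, I = ∫ x, ‖strainFlat v x‖ ^ (q - 2) * ∑ k, ∑ i, ∑ j,
      ((partialDeriv k (partialDeriv j v) x i +
        partialDeriv k (partialDeriv i v) x j) / 2) ^ 2 := ⟨_, rfl⟩
  rw [← hF, ← hZ, ← hI]
  have hF0 : 0 ≤ F := by rw [hF]; exact integral_nonneg fun x => Real.rpow_nonneg (norm_nonneg _) _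
  have hG0 : 0 ≤ G := by rw [hG]; exact integral_nonneg fun x => Real.rpow_nonneg (hg0 x) _
  have hA₂0 : 0 ≤ A₂ := by rw [hA₂]; exact integral_nonneg fun x => Real.rpow_nonneg (norm_nonneg _) _
  have hA0 : 0 ≤ A := by rw [hA]; exact integral_nonneg fun x => Real.rpow_nonneg (norm_nonneg _) _
  have hZ0 : 0 ≤ Z := by rw [hZ]; exact integral_nonneg fun x => Real.rpow_nonneg (norm_nonneg _) _
  -- the five inputs and the top node
  have h1 : |∫ x, torusStrainSqAt v x ^ (q / 2 - 1) * ∑ i, ∑ j,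
      (partialDeriv j v x i + partialDeriv i v x j) / 2 *
        ∑ k, partialDeriv i v x k * partialDeriv k v x j| ≤
      Real.sqrt 2 * (F ^ ((q - 1) / q) * G ^ (1 / q)) := by
    have h := abs_nonlinear_production_le hv hq.le
    have h' := integral_rpow_mul_le_holder hφc.norm hgc (fun x => norm_nonneg _) hg0
      (by linarith : 1 < q)
    rw [← hF, ← hG] at h'
    have hP0 : 0 ≤ F ^ ((q - 1) / q) * G ^ (1 / q) :=
      mul_nonneg (Real.rpow_nonneg hF0 _) (Real.rpow_nonneg hG0 _)
    have h2 : (1 : ℝ) ≤ Real.sqrt 2 := Real.one_le_sqrt.2 (by norm_num)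
    calc _ ≤ F ^ ((q - 1) / q) * G ^ (1 / q) := h.trans h'
      _ = 1 * (F ^ ((q - 1) / q) * G ^ (1 / q)) := (one_mul _).symm
      _ ≤ Real.sqrt 2 * (F ^ ((q - 1) / q) * G ^ (1 / q)) := mul_le_mul_of_nonneg_right h2 hP0
  have h2 : G ≤ K * A₂ := by rw [hG, hA₂]; exact hK v hv hdiv
  have h3 : A₂ ^ 2 ≤ F * A := by rw [hA₂, hF, hA]; exact moment_two_q_sq_le hφc (by linarith)
  have h4 : A ≤ CT * I ^ 3 := by rw [hA, hI]; exact hCT v hv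
  have h5 : F ≤ Z ^ (2 * q / (3 * q - 2)) * A ^ (1 - 2 * q / (3 * q - 2)) := by
    rw [hF, hZ, hA]; exact moment_q_le_interp hφc hq
  exact VorticityMoment.production_rpow_bookkeeping hq hF0 hG0 hA₂0 hA0 hZ0 hK0 h1 h2 h3 h4 h5

/-! ## 3. The pressure production -/

/-- **Pressure production bound (static along a solution, `T³`, real `q > 2`).** With `C_T`, `K` as
above and a pressure-Hessian constant `C_P` at the exponent `q` (`∫|∂ᵢ∂ⱼp|^q ≤ C_P∫g^q` along the
solution): along every classical solution of unforced Navier–Stokes on `T³`, at every time `t` of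
the window,
`|∫(|S|²)^{q/2−1}∑ᵢⱼSᵢⱼ∂ᵢ∂ⱼp| ≤ √2 (9^q C_P K)^{1/q} (C_T I³)^{a/3} (∫φ² · (∫φ^q)^{1+1/(2q−3)})^{1−a}`.
[ours] -/
theorem pressure_production_rpow_le {CT K CP q : ℝ} (hK0 : 0 ≤ K) (hCP0 : 0 ≤ CP) (hq : 2 < q)
    (hCT : ∀ w : UnitAddTorus (Fin 3) → EuclideanSpace ℝ (Fin 3), IsSmooth w →
      ∫ x, ‖strainFlat w x‖ ^ (3 * q) ≤
        CT * (∫ x, ‖strainFlat w x‖ ^ (q - 2) * ∑ k, ∑ i, ∑ j,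
          ((partialDeriv k (partialDeriv j w) x i +
            partialDeriv k (partialDeriv i w) x j) / 2) ^ 2) ^ 3)
    (hK : ∀ w : UnitAddTorus (Fin 3) → EuclideanSpace ℝ (Fin 3), IsSmooth w → IsDivFree w →
      ∫ x, (∑ k, ‖partialDeriv k w x‖ ^ 2) ^ q ≤ K * ∫ x, ‖strainFlat w x‖ ^ (2 * q))
    {a b ν : ℝ}
    {u : ℝ → UnitAddTorus (Fin 3) → EuclideanSpace ℝ (Fin 3)} {p : ℝ → UnitAddTorus (Fin 3) → ℝ}
    (hsol : IsClassicalNSSolutionOn (Icc a b) ν 0 u p)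
    (hCP : ∀ t ∈ Icc a b, ∀ i j : Fin 3,
      ∫ x, |partialDeriv i (partialDeriv j (p t)) x| ^ q ≤
        CP * ∫ x, (∑ k, ‖partialDeriv k (u t) x‖ ^ 2) ^ q)
    {t : ℝ} (ht : t ∈ Icc a b) :
    |∫ x, torusStrainSqAt (u t) x ^ (q / 2 - 1) * ∑ i, ∑ j,
        (partialDeriv j (u t) x i + partialDeriv i (u t) x j) / 2 *
          partialDeriv i (partialDeriv j (p t)) x| ≤
      Real.sqrt 2 * ((9 : ℝ) ^ q * CP * K) ^ (1 / q) *
        (CT * (∫ x, ‖strainFlat (u t) x‖ ^ (q - 2) * ∑ k, ∑ i, ∑ j,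
          ((partialDeriv k (partialDeriv j (u t)) x i +
            partialDeriv k (partialDeriv i (u t)) x j) / 2) ^ 2) ^ 3) ^
          ((3 * q - 3) / (5 * q - 6) / 3) *
        ((∫ x, ‖strainFlat (u t) x‖ ^ (2 : ℝ)) *
          (∫ x, ‖strainFlat (u t) x‖ ^ q) ^ (1 + (2 * q - 3)⁻¹)) ^
          (1 - (3 * q - 3) / (5 * q - 6)) := by
  have hv : IsSmooth (u t) := hsol.smooth_velocity.isSmooth_slice ht
  have hdiv : IsDivFree (u t) := hsol.divFree t ht
  have hpt : IsSmooth (p t) := hsol.smooth_pressure.isSmooth_slice ht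
  have hφc : Continuous (strainFlat (u t)) := continuous_strainFlat hv
  have hhc := continuous_hessAbs hpt
  have hh0 : ∀ x, 0 ≤ ∑ i, ∑ j, |partialDeriv i (partialDeriv j (p t)) x| := fun x =>
    Finset.sum_nonneg fun i _ => Finset.sum_nonneg fun j _ => abs_nonneg _
  have hg0 : ∀ x, 0 ≤ ∑ k, ‖partialDeriv k (u t) x‖ ^ 2 := fun x =>
    Finset.sum_nonneg fun k _ => sq_nonneg _
  have hq1 : (1 : ℝ) ≤ q := by linarith
  -- the quantities
  obtain ⟨F, hF⟩ : ∃ F : ℝ, F = ∫ x, ‖strainFlat (u t) x‖ ^ q := ⟨_, rfl⟩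
  obtain ⟨Hq, hHq⟩ : ∃ H : ℝ, H = ∫ x, (∑ i, ∑ j, |partialDeriv i (partialDeriv j (p t)) x|) ^ q :=
    ⟨_, rfl⟩
  obtain ⟨G, hG⟩ : ∃ G : ℝ, G = ∫ x, (∑ k, ‖partialDeriv k (u t) x‖ ^ 2) ^ q := ⟨_, rfl⟩
  obtain ⟨A₂, hA₂⟩ : ∃ A : ℝ, A = ∫ x, ‖strainFlat (u t) x‖ ^ (2 * q) := ⟨_, rfl⟩
  obtain ⟨A, hA⟩ : ∃ A : ℝ, A = ∫ x, ‖strainFlat (u t) x‖ ^ (3 * q) := ⟨_, rfl⟩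
  obtain ⟨Z, hZ⟩ : ∃ Z : ℝ, Z = ∫ x, ‖strainFlat (u t) x‖ ^ (2 : ℝ) := ⟨_, rfl⟩
  obtain ⟨I, hI⟩ : ∃ I : ℝ, I = ∫ x, ‖strainFlat (u t) x‖ ^ (q - 2) * ∑ k, ∑ i, ∑ j,
      ((partialDeriv k (partialDeriv j (u t)) x i +
        partialDeriv k (partialDeriv i (u t)) x j) / 2) ^ 2 := ⟨_, rfl⟩
  rw [← hF, ← hZ, ← hI]
  have hF0 : 0 ≤ F := by rw [hF]; exact integral_nonneg fun x => Real.rpow_nonneg (norm_nonneg _) _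
  have hHq0 : 0 ≤ Hq := by rw [hHq]; exact integral_nonneg fun x => Real.rpow_nonneg (hh0 x) _
  have hG0 : 0 ≤ G := by rw [hG]; exact integral_nonneg fun x => Real.rpow_nonneg (hg0 x) _
  have hA₂0 : 0 ≤ A₂ := by rw [hA₂]; exact integral_nonneg fun x => Real.rpow_nonneg (norm_nonneg _) _
  have hA0 : 0 ≤ A := by rw [hA]; exact integral_nonneg fun x => Real.rpow_nonneg (norm_nonneg _) _
  have hZ0 : 0 ≤ Z := by rw [hZ]; exact integral_nonneg fun x => Real.rpow_nonneg (norm_nonneg _) _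
  -- the five inputs
  have h1 : |∫ x, torusStrainSqAt (u t) x ^ (q / 2 - 1) * ∑ i, ∑ j,
      (partialDeriv j (u t) x i + partialDeriv i (u t) x j) / 2 *
        partialDeriv i (partialDeriv j (p t)) x| ≤
      Real.sqrt 2 * (F ^ ((q - 1) / q) * Hq ^ (1 / q)) := by
    have h := abs_pressure_production_le hv hpt hq.le
    have h' := integral_rpow_mul_le_holder hφc.norm hhc (fun x => norm_nonneg _) hh0
      (by linarith : 1 < q)
    rw [← hF, ← hHq] at h'
    have hP0 : 0 ≤ F ^ ((q - 1) / q) * Hq ^ (1 / q) :=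
      mul_nonneg (Real.rpow_nonneg hF0 _) (Real.rpow_nonneg hHq0 _)
    have h2 : (1 : ℝ) ≤ Real.sqrt 2 := Real.one_le_sqrt.2 (by norm_num)
    calc _ ≤ F ^ ((q - 1) / q) * Hq ^ (1 / q) := h.trans h'
      _ = 1 * (F ^ ((q - 1) / q) * Hq ^ (1 / q)) := (one_mul _).symm
      _ ≤ Real.sqrt 2 * (F ^ ((q - 1) / q) * Hq ^ (1 / q)) := mul_le_mul_of_nonneg_right h2 hP0
  -- `∫h^q ≤ 9^{q-1} ∑ᵢⱼ ∫|Hᵢⱼ|^q ≤ 9^{q-1}·9·C_P·G ≤ 9^q C_P K A₂`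
  have h2 : Hq ≤ (9 : ℝ) ^ q * CP * K * A₂ := by
    have hH := integral_sum_abs_rpow_le (d := Fin 3)
      (H := fun i j x => partialDeriv i (partialDeriv j (p t)) x)
      (fun i j => ((hpt.partialDeriv j).partialDeriv i).continuous) hq1
    simp only [Fintype.card_fin, Nat.cast_ofNat] at hH
    have hsum : ∑ i : Fin 3, ∑ j : Fin 3, ∫ x, |partialDeriv i (partialDeriv j (p t)) x| ^ q ≤
        ∑ i : Fin 3, ∑ j : Fin 3, CP * G := by
      refine Finset.sum_le_sum fun i _ => Finset.sum_le_sum fun j _ => ?_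
      rw [hG]; exact hCP t ht i j
    have hsum' : ∑ i : Fin 3, ∑ j : Fin 3, CP * G = 9 * (CP * G) := by
      simp only [Finset.sum_const, Finset.card_univ, Fintype.card_fin]
      ring
    have hGle : G ≤ K * A₂ := by rw [hG, hA₂]; exact hK (u t) hv hdiv
    have h9 : ((3 : ℝ) ^ 2) ^ (q - 1) * 9 = (9 : ℝ) ^ q := by
      rw [show (3 : ℝ) ^ 2 = 9 by norm_num, Real.rpow_sub (by norm_num : (0 : ℝ) < 9),
        Real.rpow_one]
      field_simp
    have h9q : 0 ≤ ((3 : ℝ) ^ 2) ^ (q - 1) := Real.rpow_nonneg (by norm_num) _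
    calc Hq ≤ ((3 : ℝ) ^ 2) ^ (q - 1) *
          ∑ i : Fin 3, ∑ j : Fin 3, ∫ x, |partialDeriv i (partialDeriv j (p t)) x| ^ q := by
          rw [hHq]; exact hH
      _ ≤ ((3 : ℝ) ^ 2) ^ (q - 1) * (9 * (CP * G)) := by
          rw [← hsum']; exact mul_le_mul_of_nonneg_left hsum h9q
      _ ≤ ((3 : ℝ) ^ 2) ^ (q - 1) * (9 * (CP * (K * A₂))) := by gcongr
      _ = (((3 : ℝ) ^ 2) ^ (q - 1) * 9) * CP * K * A₂ := by ring
      _ = (9 : ℝ) ^ q * CP * K * A₂ := by rw [h9]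
  have h3 : A₂ ^ 2 ≤ F * A := by rw [hA₂, hF, hA]; exact moment_two_q_sq_le hφc (by linarith)
  have h4 : A ≤ CT * I ^ 3 := by rw [hA, hI]; exact hCT (u t) hv
  have h5 : F ≤ Z ^ (2 * q / (3 * q - 2)) * A ^ (1 - 2 * q / (3 * q - 2)) := by
    rw [hF, hZ, hA]; exact moment_q_le_interp hφc hq
  exact VorticityMoment.production_rpow_bookkeeping hq hF0 hHq0 hA₂0 hA0 hZ0 (by positivity)
    h1 h2 h3 h4 h5

end StrainMoment

end Summit.NavierStokesRegularity.FunctionalMining
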